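import Summits.QuantumFields.YangMills.Theorems.BalabanUVNodesN15KingModelFullPropagatorOperatorDecay

/-!
# BalabanUVNodes ∕ N15 — THE KING-MODEL RUNG, CURVED EDITION (PART P″): THE PRINTED SHAPE — `|(G^{η′}_{K+n}τλ)(x′) − (G^η_Kλ)(x)| ≤
# C·(L^{−γ∕2})^K·e^{−δ·dist(B(x), supp λ)}·‖λ‖_∞` for EVERY source `λ` on the η-lattice, `τλ = λ∘π` its refinement to the η′-lattice
# (King p. 664 «x′ ∈ B^n(x)»), the propagators King's ∕ Bałaban's OPERATORS `A₀⁻¹ = G_K(T_ε, 0)` — (3.7) with the (3.71) rate, all sources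
# (Track A, DAG node N15 = NE2; FAN-OUT v1.1 §N15 s3 «KING-MODEL RUNG … + the one-line statement of what the curved case adds»)

HONEST FRAMING.  Count-neutral kernel bookkeeping (cell `pub-ymgap`, seat `pub-ymgap-dag-n15-e` g6; `--supports stmt-QuantumFields-19912
--as helper` = K3‴ `SpineGivenEndpointR13`, lineage K3 19676 → K3′ 19908).  TEMPLATE LITERATURE, `A = 0`: C. King's scalar U(1)-Higgs MODEL
on finite tori ([King1986] (2.13)–(2.17) p. 653, (2.20) p. 654, Theorem 3.3 (3.7) p. 658, Prop. 3.8 (3.71) p. 664, p. 664 «When x′ ∈ T_{η′}, we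
denote by x that point in T_η for which x′ ∈ B^n(x)»; [B9] Thm 3.1 (3.42) p. 397 (entry `n = 0`: `sup|(G(U)λ)(x)|`, the typing template of NE2's
operator layer)), NOT Bałaban's covariant objects; the statement is the (2.17)-summed SHAPE of (3.7) + (3.71) for the OPERATORS, not a printed
proposition; NE2⁺ is NOT PRINTED for those and not proved here; NOT a node discharge; nothing continuum ∕ ℝ⁴ ∕ OS ∕ mass-gap ∕ Clay.
0 `sorry`, 0 `def`, standard axioms.

THE POINT.  Part P′ (`fullPropOp_rate_decay_unif`) bounds `Σ_{y′} η′^{d+1}[G^{η′}_{K+n}(x′, y′) − G^η_K(x, y)]f′(y′)` for every fine source `f′`.  For a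
source `λ` on the COARSE η-lattice refined to the fine one, `f′ = λ∘π` (`π = underPtN`, King's pairing), that sum IS the difference of the two
OPERATORS applied to `λ`: `(A₀′⁻¹(λ∘π))(x′) − (A₀⁻¹λ)(x)` with `A₀⁻¹ = (L^K)^{−(d+1)}G^η_K` = Bałaban's `G_K(T_ε, 0)` (`MinimizerTowerBridge.fineOp_inv_
toTor_toTor`) — because every η-point has exactly `(L^n)^{d+1}` η′-points over it:
* §1 `underPtN_eq_blockOf` (King's pairing IS the `L^n`-block map of the nested torus, `TorusCongr` spelling), **`sum_comp_underPtN`**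
  (`Σ_{y′} φ(π y′) = (L^n)^{d+1}·Σ_y φ(y)`, part P `sum_fine_blockOf` through `torCongr`), `inv_mulVec_eq_sum` (`(A₀⁻¹f)(x) = Σ_y N^{−(d+1)}G(x, y)f(y)`);
* §2 ★★ **`fullPropOp_rate_printed`**: `∃ C δ > 0 ∀ K n ≥ 1 ∀ cube M_μ = 2L^e ∀ 0 < m² ≤ m₀² ∀ λ (|λ| ≤ F) ∀ (D : ℕ) ∀ x′, (λ = 0 on the η-points whose
  unit block is within torus distance < D of B(x)) → |((fineOp (L^nL^K) M a_{K+n} (L^nL^K)² m²)⁻¹(λ∘π))(x′) − ((fineOp (L^K) M a_K (L^K)² m²)⁻¹λ)(x)|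
  ≤ C·(L^{−γ∕2})^K·e^{−δD}·F` (`x = π x′`), and `fullPropOp_rate_printed_sup` (`D = 0`: the plain sup-norm rate).
WHAT THE CURVED CASE ADDS (one line): Bałaban's `G_k(U)` in the same entry, uniformly over the live window `Reg335` ([B9] (3.35)); print gives
analyticity in `U` and η-uniformity (Thm 3.4), never an η-difference.  A typed `EtaRateIneq342` reading needs a `B9.Geometry` whose test
functions live on the η-lattice (the tree's `torusOpGeo` carries unit-torus test functions, on which `A₀⁻¹Q^*` is the minimiser — g2's H-layer).
HONEST SCOPE.  (i) `A = 0`, periodic b.c., odd `L ≥ 3`, `0 < m² ≤ m₀²`, cubes `2L^e`; (ii) distances of unit BLOCKS (King's `dist` ≥ it − 2); (iii) `K, n ≥ 1`;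
(iv) not Bałaban's `G_k(U)`; not a discharge.
Locators: [King1986] C. King, CMP **102** (1986) 649–677: (2.13)–(2.17) p. 653, (2.20) p. 654, Theorem 3.3 (3.7) p. 658, Prop. 3.8 (3.71) p. 664;
[Ba 4] = [Balaban1983RegularityDecay] Theorem (1.10) p. 573; [B9] = [Balaban1985BackgroundPropagators] Thm 3.1 (3.42) p. 397.
-/

noncomputable section

namespace Summit.QuantumFields.YangMills.BalabanUVNodes.N15KingModelRung.Curved

open Real Finset Matrix
open Literature.MathematicalPhysics.QuantumFieldTheory.Balaban1983to89.B5Prop11Plancherel (Tor fine)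
open Literature.MathematicalPhysics.QuantumFieldTheory.King1986 (aK aK_pos)
open Literature.MathematicalPhysics.QuantumFieldTheory.King1986.Torus (constrainedProp fineOp blockOf tdistT torCongr val_torCongr
  val_blockOf fine_fine tdistT_nonneg)

variable {d : ℕ} (L : ℕ) [NeZero L]

/-! ## §1 Every η-point has `(L^n)^{d+1}` η′-points over it -/

omit [NeZero L] in
/-- The spelling bridge `L^nL^K·M_μ = L^n·(L^K·M_μ)` for the fine periods. [cite: King1986, (2.10) p.653] -/
theorem fine_mul_assoc (K n : ℕ) (M : Fin (d + 1) → ℕ) :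
    ∀ μ, fine (L ^ n * L ^ K) M μ = fine (L ^ n) (fine (L ^ K) M) μ :=
  fun μ => (fine_fine (L ^ n) (L ^ K) M μ).symm

/-- **King's pairing IS the `L^n`-block map of the nested torus**: `π y′ = blockOf (L^n) (fine L^K M) (e y′)` along the spelling bridge (labels
`⌊y′_μ∕L^n⌋` either way). [cite: King1986, p.664 («x′ ∈ B^n(x)»), (2.10) p.653] -/
theorem underPtN_eq_blockOf (K n : ℕ) (M : Fin (d + 1) → ℕ) [∀ μ, NeZero (M μ)] (y' : Tor (fine (L ^ n * L ^ K) M)) :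
    underPtN L K n M y' = blockOf (L ^ n) (fine (L ^ K) M) (torCongr (fine_mul_assoc L K n M) y') := by
  funext μ
  apply ZMod.val_injective
  rw [val_underPtN, val_blockOf, val_torCongr]

/-- **`Σ_{y′} φ(π y′) = (L^n)^{d+1}·Σ_y φ(y)`**: summing a function of the coarse point over the fine torus counts the `(L^n)^{d+1}` fine points of each
`n`-block (part P `sum_fine_blockOf` through `torCongr`). [cite: King1986, (2.4) p.652 (the block mean `Q`), p.664] -/
theorem sum_comp_underPtN (K n : ℕ) (M : Fin (d + 1) → ℕ) [∀ μ, NeZero (M μ)] (φ : Tor (fine (L ^ K) M) → ℝ) :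
    ∑ y' : Tor (fine (L ^ n * L ^ K) M), φ (underPtN L K n M y')
      = (((L ^ n : ℕ) : ℝ) ^ (d + 1)) * ∑ y, φ y := by
  have h1 : ∑ y' : Tor (fine (L ^ n * L ^ K) M), φ (underPtN L K n M y')
      = ∑ y' : Tor (fine (L ^ n * L ^ K) M), φ (blockOf (L ^ n) (fine (L ^ K) M) (torCongr (fine_mul_assoc L K n M) y')) :=
    Finset.sum_congr rfl fun y' _ => by rw [underPtN_eq_blockOf]
  rw [h1, (torCongr (fine_mul_assoc L K n M)).sum_comp (fun z => φ (blockOf (L ^ n) (fine (L ^ K) M) z)),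
    sum_fine_blockOf (L ^ n) (fine (L ^ K) M) φ]

omit [NeZero L] in
/-- `(A₀⁻¹f)(x) = Σ_y N^{−(d+1)}·G(x, y)·f(y)` (`G = N^{d+1}·A₀⁻¹`, `CovarianceSplitting.constrainedProp`). [cite: King1986, (2.13) p.653, (4.44) p.675] -/
theorem inv_mulVec_eq_sum (N : ℕ) [NeZero N] (M : Fin (d + 1) → ℕ) [∀ μ, NeZero (M μ)] (a c m2 : ℝ)
    (f : Tor (fine N M) → ℝ) (x : Tor (fine N M)) :
    ((fineOp N M a c m2)⁻¹ *ᵥ f) x = ∑ y, ((N : ℝ) ^ (d + 1))⁻¹ * constrainedProp N M a c m2 x y * f y := by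
  have hN : ((N : ℝ) ^ (d + 1)) ≠ 0 := pow_ne_zero _ (by exact_mod_cast NeZero.ne N)
  rw [Matrix.mulVec, dotProduct]
  refine Finset.sum_congr rfl fun y _ => ?_
  rw [constrainedProp, Matrix.smul_apply, smul_eq_mul, ← mul_assoc, inv_mul_cancel₀ hN, one_mul]

/-! ## §2 The printed shape -/

/-- **`|(G^{η′}_{K+n}τλ)(x′) − (G^η_Kλ)(x)| ≤ C·(L^{−γ∕2})^K·e^{−δ·dist(B(x), supp λ)}·‖λ‖_∞` FOR EVERY SOURCE `λ` ON THE η-LATTICE** (`τλ = λ∘π` its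
refinement, `x = π x′`; the operators are King's ∕ Bałaban's `A₀⁻¹ = (fineOp …)⁻¹ = G_K(T_ε, 0)`, [Ba 4] (1.6)): for odd `L ≥ 3`, `a > 0`, a mass cap
`m₀² ≥ 0` and `0 ≤ γ ≤ 1` there are `C, δ > 0` such that for EVERY `K ≥ 1`, `n ≥ 1`, cube `M_μ = 2L^e`, mass `0 < m² ≤ m₀²`, every `λ` with `|λ| ≤ F`,
every `D ∈ ℕ` and fine point `x′` with `λ(y) = 0` whenever `|B(x) − B(y)|_M < D`:
`|((fineOp (L^nL^K) M a_{K+n} (L^nL^K)² m²)⁻¹(λ∘π))(x′) − ((fineOp (L^K) M a_K (L^K)² m²)⁻¹λ)(x)| ≤ C·(L^{−γ∕2})^K·e^{−δD}·F` — Theorem 3.3 (3.7)'s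
sup-norm-with-decay SHAPE carrying Prop. 3.8's two-spacing rate, for the FULL `A = 0` fluctuation propagator, uniformly in the number of levels,
the volume and the mass (part P′ at `f′ = λ∘π` + §1). [cite: King1986, Theorem 3.3 (3.7) p.658, Prop. 3.8 (3.71) p.664, p.664, (2.17) p.653; Balaban1983RegularityDecay, Theorem (1.10) p.573; Balaban1985BackgroundPropagators, Thm 3.1 (3.42) p.397 (entry shape)] -/
theorem fullPropOp_rate_printed (hLodd : Odd L) (hL : 2 ≤ L) {a : ℝ} (ha : 0 < a) {m0sq : ℝ} (hm0 : 0 ≤ m0sq) {γ : ℝ}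
    (hγ0 : 0 ≤ γ) (hγ1 : γ ≤ 1) :
    ∃ C δ : ℝ, 0 < C ∧ 0 < δ ∧ ∀ (K : ℕ), 1 ≤ K → ∀ (n : ℕ), 1 ≤ n →
      ∀ (e : ℕ) (M : Fin (d + 1) → ℕ) [∀ μ, NeZero (M μ)], (∀ μ, M μ = 2 * L ^ e) →
      ∀ (msq : ℝ), 0 < msq → msq ≤ m0sq →
      ∀ (lam : Tor (fine (L ^ K) M) → ℝ) (F : ℝ), (∀ y, |lam y| ≤ F) → ∀ (D : ℕ) (x' : Tor (fine (L ^ n * L ^ K) M)),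
        (∀ y, lam y ≠ 0 → (D : ℝ) ≤ tdistT M (blockOf (L ^ K) M (underPtN L K n M x')) (blockOf (L ^ K) M y)) →
        |((fineOp (L ^ n * L ^ K) M (aK a L (K + n)) (((L ^ n * L ^ K : ℕ) : ℝ) ^ 2) msq)⁻¹
              *ᵥ (fun y' => lam (underPtN L K n M y'))) x'
          - ((fineOp (L ^ K) M (aK a L K) (((L ^ K : ℕ) : ℝ) ^ 2) msq)⁻¹ *ᵥ lam) (underPtN L K n M x')|
          ≤ C * (((L : ℝ) ^ (-(γ / 2))) ^ K) * Real.exp (-(δ * D)) * F := by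
  obtain ⟨C, δ, hC, hδ, H⟩ := fullPropOp_rate_decay_unif (d := d) L hLodd hL ha hm0 hγ0 hγ1
  refine ⟨C, δ, hC, hδ, ?_⟩
  intro K hK n hn e M _ hM msq hmsq hcap lam F hF D x' hsupp
  have hLK : (((L ^ K : ℕ) : ℝ) ^ (d + 1)) ≠ 0 := pow_ne_zero _ (by exact_mod_cast NeZero.ne (L ^ K))
  have hLn : (((L ^ n : ℕ) : ℝ) ^ (d + 1)) ≠ 0 := pow_ne_zero _ (by exact_mod_cast NeZero.ne (L ^ n))
  -- part P′ at the refined source `λ∘π`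
  have h := H K hK n hn e M hM msq hmsq hcap (fun y' => lam (underPtN L K n M y')) F (fun y' => hF _) D x'
    (fun y' hy => hsupp _ hy)
  -- the two operators as sums over the fine torus
  have hfine : ((fineOp (L ^ n * L ^ K) M (aK a L (K + n)) (((L ^ n * L ^ K : ℕ) : ℝ) ^ 2) msq)⁻¹
        *ᵥ (fun y' => lam (underPtN L K n M y'))) x'
      = ∑ y', (((L ^ n * L ^ K : ℕ) : ℝ) ^ (d + 1))⁻¹
          * constrainedProp (L ^ n * L ^ K) M (aK a L (K + n)) (((L ^ n * L ^ K : ℕ) : ℝ) ^ 2) msq x' y'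
          * lam (underPtN L K n M y') :=
    inv_mulVec_eq_sum (L ^ n * L ^ K) M _ _ _ _ x'
  have hcoarse : ((fineOp (L ^ K) M (aK a L K) (((L ^ K : ℕ) : ℝ) ^ 2) msq)⁻¹ *ᵥ lam) (underPtN L K n M x')
      = ∑ y', (((L ^ n * L ^ K : ℕ) : ℝ) ^ (d + 1))⁻¹
          * constrainedProp (L ^ K) M (aK a L K) (((L ^ K : ℕ) : ℝ) ^ 2) msq (underPtN L K n M x') (underPtN L K n M y')
          * lam (underPtN L K n M y') := by
    rw [inv_mulVec_eq_sum (L ^ K) M _ _ _ lam,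
      sum_comp_underPtN L K n M (fun y => (((L ^ n * L ^ K : ℕ) : ℝ) ^ (d + 1))⁻¹
        * constrainedProp (L ^ K) M (aK a L K) (((L ^ K : ℕ) : ℝ) ^ 2) msq (underPtN L K n M x') y * lam y),
      Finset.mul_sum]
    refine Finset.sum_congr rfl fun y _ => ?_
    push_cast
    field_simp
    ring
  have hdiff : ((fineOp (L ^ n * L ^ K) M (aK a L (K + n)) (((L ^ n * L ^ K : ℕ) : ℝ) ^ 2) msq)⁻¹
          *ᵥ (fun y' => lam (underPtN L K n M y'))) x'
        - ((fineOp (L ^ K) M (aK a L K) (((L ^ K : ℕ) : ℝ) ^ 2) msq)⁻¹ *ᵥ lam) (underPtN L K n M x')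
      = ∑ y', ((((L ^ n * L ^ K : ℕ) : ℝ) ^ (d + 1))⁻¹ *
            (constrainedProp (L ^ n * L ^ K) M (aK a L (K + n)) (((L ^ n * L ^ K : ℕ) : ℝ) ^ 2) msq x' y'
              - constrainedProp (L ^ K) M (aK a L K) (((L ^ K : ℕ) : ℝ) ^ 2) msq
                (underPtN L K n M x') (underPtN L K n M y'))
            * lam (underPtN L K n M y')) := by
    rw [hfine, hcoarse, ← Finset.sum_sub_distrib]
    exact Finset.sum_congr rfl fun y' _ => by ring
  rw [hdiff]
  exact h

/-- **The plain sup-norm rate, all sources** (`D = 0`): `|(G^{η′}_{K+n}(λ∘π))(x′) − (G^η_Kλ)(x)| ≤ C·(L^{−γ∕2})^K·‖λ‖_∞` — the block-spin fluctuation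
propagators CONVERGE as OPERATORS at the geometric rate `(L^{−γ∕2})^K`, uniformly in the volume and the mass.
[cite: King1986, Theorem 3.3 (3.7) p.658, Prop. 3.8 (3.71) p.664, (2.17) p.653] -/
theorem fullPropOp_rate_printed_sup (hLodd : Odd L) (hL : 2 ≤ L) {a : ℝ} (ha : 0 < a) {m0sq : ℝ} (hm0 : 0 ≤ m0sq) {γ : ℝ}
    (hγ0 : 0 ≤ γ) (hγ1 : γ ≤ 1) :
    ∃ C : ℝ, 0 < C ∧ ∀ (K : ℕ), 1 ≤ K → ∀ (n : ℕ), 1 ≤ n →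
      ∀ (e : ℕ) (M : Fin (d + 1) → ℕ) [∀ μ, NeZero (M μ)], (∀ μ, M μ = 2 * L ^ e) →
      ∀ (msq : ℝ), 0 < msq → msq ≤ m0sq →
      ∀ (lam : Tor (fine (L ^ K) M) → ℝ) (F : ℝ), (∀ y, |lam y| ≤ F) → ∀ x' : Tor (fine (L ^ n * L ^ K) M),
        |((fineOp (L ^ n * L ^ K) M (aK a L (K + n)) (((L ^ n * L ^ K : ℕ) : ℝ) ^ 2) msq)⁻¹
              *ᵥ (fun y' => lam (underPtN L K n M y'))) x'
          - ((fineOp (L ^ K) M (aK a L K) (((L ^ K : ℕ) : ℝ) ^ 2) msq)⁻¹ *ᵥ lam) (underPtN L K n M x')|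
          ≤ C * (((L : ℝ) ^ (-(γ / 2))) ^ K) * F := by
  obtain ⟨C, δ, hC, hδ, H⟩ := fullPropOp_rate_printed (d := d) L hLodd hL ha hm0 hγ0 hγ1
  refine ⟨C, hC, ?_⟩
  intro K hK n hn e M _ hM msq hmsq hcap lam F hF x'
  have h := H K hK n hn e M hM msq hmsq hcap lam F hF 0 x' (fun y _ => by rw [Nat.cast_zero]; exact tdistT_nonneg M _ _)
  rwa [Nat.cast_zero, mul_zero, neg_zero, Real.exp_zero, mul_one] at h

end Summit.QuantumFields.YangMills.BalabanUVNodes.N15KingModelRung.Curved
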